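import Literature.Barriers.CriticalPhenomena.PlaquetteWalkHoleRootPocketChains
import HarnessLib

/-!
# Barrier catalogue (SAWScalingLimit): THE ROOT PLAQUETTE'S EXITS — a class-`B2a` walk leaves the root plaquette through a side that is
live AND crossed; all three exits dead or uncrossable (dead ends, pocket chains) ⇒ no walk, `V ≡ 0`

Leaf of `PlaquetteWalkHoleRootPocketChains` (cone: `ΩG.false_of_rootSealed` of `PlaquetteWalkHoleRootSealedDoors`, the pocket-chain lemma
`ΩG.nth_ne_entrance_of_pocketChain`, `nth_ne_side_of_deadEnd`). Setting: root plaquette `w` rooted at `W`, hole `holeFaceW w ∉ D`, far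
cell `farW w`; the three EXITS of `w` are its sides `S`, `N`, `E` (towards `rootS w`, `rootN w`, `rootE = (w.1 + 1, w.2)`).

The far cell has three doors and the root plaquette has three exits; `PlaquetteWalkHoleRootSealedDoors` / `…SealedPocket` / `…PocketChains`
sealed the far doors (dead, dead end, pocket, chain) and the root plaquette only when all three exit cells are ABSENT. This file gives
the root plaquette the same per-walk treatment:

* §1 ★★★ `ΩG.nth_one_eq_root_side` — the first mid-edge after the root edge is a side `w.side t`, `t ≠ W`, of the root plaquette, and it is
  a door (both faces in `D`); ★★★★ `ΩG.false_of_rootExits_uncrossed` — if each exit `w.side t` (`t ≠ W`) is DEAD (a face absent) or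
  UNCROSSED by `ω` (no index `1 ≤ i ≤ length` with `nth i = w.side t`), then the class-`B2a` walk `ω` does not exist; so
  ★★★★ `ΩG.false_of_rootExits_pocketChains` — each exit dead or the entrance of a pocket chain ⇒ no walk (e.g. `rootS` present but a dead
  end, `rootN` absent, `rootE` opening into a sealed corridor).
* §2 ★★★ `vertexFunctional_printed_eq_zero_of_rootExit_deadEnds` — the simplest new configuration beyond the sealed root: the three exit
  cells may be PRESENT but each a dead end (its three outer sides dead) ⇒ `V ≡ 0` on `[π/3, 2π/3]`, any domain.

Not in print; venture lane «pcv-sawmu», seat b-step0 gen 30 (rule (R3) of the deciding theory in its per-walk form, FINDING-YB-KILL-FORCED-ZEROS §28 add. 9–10).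

References: A. Glazman, Electron. Commun. Probab. 20 (2015) no. 86, Lemma 3.1, proof pp. 6–7 [Glazman2015WeightedSAW]; A. Glazman,
I. Manolescu, arXiv:1708.00395v3, §1 (Fig. 1: an arc joins two sides of its rhombus), §2.1, Lemma 2.1 [GlazmanManolescu2019].
-/

noncomputable section

open Set Function Complex

namespace Literature.Probability.RandomPlanarGeometry.SAW.YangBaxter

open Real

namespace ΩG

variable {D : Set Face} {w : Face}

/-! ## §1 The first exit of a walk from the root edge -/

/-- ★★★ **THE FIRST EXIT.** Hole absent; for a class-`B2a` walk `ω` at the far cell, the mid-edge `nth 1` is a side `w.side t` of the root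
plaquette with `t ≠ W`, and both its faces lie in `D` (the first arc lies in `w`, `fc_zero_eq_root`; interior mid-edges are doors, `door_nth`).
[cite: Glazman2015WeightedSAW, Lemma 3.1 (proof, pp. 6–7)] [cite: GlazmanManolescu2019, §1 (Fig. 1: an arc joins two sides of its rhombus)] -/
theorem nth_one_eq_root_side (hh : holeFaceW w ∉ D) (ω : ΩG D (w.side .W) (farW w)) (h : ω.IsB2a) :
    ∃ t : Side, t ≠ .W ∧ ω.2.nth 1 = w.side t ∧ (w.side t).faces.1 ∈ D ∧ (w.side t).faces.2 ∈ D := by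
  have hB2 : ω.2.firstHitG + 1 < ω.2.arcs.length := h.1
  have h0 : 0 < ω.2.arcs.length := by omega
  have hfc := fc_zero_eq_root (w := w) hh ω.2 h0
  obtain ⟨hin, hout, hio⟩ := ω.2.side_sIn_nth (i := 0) h0
  rw [hfc] at hin hout
  rw [ω.2.nth_zero] at hin
  have hsin : ω.2.sIn 0 = .W := (Face.side_injective w (hin.symm)).symm
  have hd := ω.2.door_nth (j := 1) (by omega) (by omega)
  rw [show (0 : ℕ) + 1 = 1 from rfl] at hout
  refine ⟨ω.2.sOut 0, fun e2 => hio (hsin.trans e2.symm), hout.symm, ?_, ?_⟩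
  · rw [hout]; exact hd.1
  · rw [hout]; exact hd.2

/-- ★★★★ **ALL THREE EXITS DEAD OR UNCROSSED ⇒ NO WALK.** If every side `w.side t`, `t ≠ W`, of the root plaquette has a face outside `D` or
is never a mid-edge of `ω` (indices `1 ≤ i ≤ length`), the class-`B2a` walk `ω` at the far cell does not exist.
[cite: Glazman2015WeightedSAW, Lemma 3.1 (proof, pp. 6–7)] [cite: GlazmanManolescu2019, §1 (Fig. 1), Lemma 2.1] -/
theorem false_of_rootExits_uncrossed (hh : holeFaceW w ∉ D) (ω : ΩG D (w.side .W) (farW w)) (h : ω.IsB2a)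
    (hex : ∀ t : Side, t ≠ .W → ((w.side t).faces.1 ∉ D ∨ (w.side t).faces.2 ∉ D) ∨
      ∀ i, 1 ≤ i → i ≤ ω.2.arcs.length → ω.2.nth i ≠ w.side t) : False := by
  have hB2 : ω.2.firstHitG + 1 < ω.2.arcs.length := h.1
  obtain ⟨t, ht, e, h1, h2⟩ := nth_one_eq_root_side hh ω h
  rcases hex t ht with (hd | hd) | hun
  · exact hd h1
  · exact hd h2
  · exact hun 1 le_rfl (by omega) e

/-- ★★★★ **EACH EXIT DEAD OR THE ENTRANCE OF A POCKET CHAIN ⇒ NO WALK.** For every side `t ≠ W` of the root plaquette: the exit is dead, or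
it is the entrance `(g t 0).side (s t 0)` of a pocket chain `g t 0, …, g t (k t)` (cells ≠ `w`, ≠ far; link sides `tl t`; every other side
dead; `PlaquetteWalkHoleRootPocketChains`). Then no class-`B2a` walk at the far cell exists.
[cite: Glazman2015WeightedSAW, Lemma 3.1 (proof, pp. 6–7)] [cite: GlazmanManolescu2019, §1 (Fig. 1), Lemma 2.1] -/
theorem false_of_rootExits_pocketChains (hh : holeFaceW w ∉ D) (ω : ΩG D (w.side .W) (farW w))
    (hr : RootedFace D (w.side .W) (farW w)) (h : ω.IsB2a)
    {k : Side → ℕ} {g : Side → ℕ → Face} {s tl : Side → ℕ → Side}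
    (hex : ∀ t : Side, t ≠ .W → ((w.side t).faces.1 ∉ D ∨ (w.side t).faces.2 ∉ D) ∨
      ((g t 0).side (s t 0) = w.side t ∧ (∀ i, i ≤ k t → g t i ≠ w) ∧ (∀ i, i ≤ k t → g t i ≠ farW w) ∧
        (∀ i, i < k t → (g t i).side (tl t i) = (g t (i + 1)).side (s t (i + 1))) ∧
        (∀ i, i ≤ k t → ∀ u : Side, u ≠ s t i → (i < k t → u ≠ tl t i) →
          ((g t i).side u).faces.1 ∉ D ∨ ((g t i).side u).faces.2 ∉ D))) : False := by
  refine false_of_rootExits_uncrossed hh ω h fun t ht => ?_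
  rcases hex t ht with hd | ⟨h0, hgw, hgf, hlink, hdead⟩
  · exact Or.inl hd
  · right
    rw [← h0]
    exact nth_ne_entrance_of_pocketChain hh hr h hgw hgf hlink hdead

/-- ★★★ **THE THREE EXIT CELLS DEAD ENDS ⇒ NO WALK.** `rootS w`, `rootN w`, `rootE = (w.1 + 1, w.2)` may be present, but each has its three
sides other than the one shared with `w` dead: `(w.1 − 1, w.2 − 1)`, `(w.1, w.2 − 2)`, `(w.1 + 1, w.2 − 1)` absent (around `rootS`),
`(w.1 − 1, w.2 + 1)`, `(w.1, w.2 + 2)`, `(w.1 + 1, w.2 + 1)` absent (around `rootN`), `(w.1 + 2, w.2)` absent (east of `rootE`; its other two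
sides are the corner cells already listed). [cite: Glazman2015WeightedSAW, Lemma 3.1 (proof, pp. 6–7)] [cite: GlazmanManolescu2019, §1 (Fig. 1), Lemma 2.1] -/
theorem false_of_rootExit_deadEnds (hh : holeFaceW w ∉ D) (ω : ΩG D (w.side .W) (farW w))
    (hr : RootedFace D (w.side .W) (farW w)) (h : ω.IsB2a)
    (h1 : ((w.1 - 1, w.2 - 1) : Face) ∉ D) (h2 : ((w.1, w.2 - 2) : Face) ∉ D) (h3 : ((w.1 + 1, w.2 - 1) : Face) ∉ D)
    (h4 : ((w.1 - 1, w.2 + 1) : Face) ∉ D) (h5 : ((w.1, w.2 + 2) : Face) ∉ D) (h6 : ((w.1 + 1, w.2 + 1) : Face) ∉ D)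
    (h7 : ((w.1 + 2, w.2) : Face) ∉ D) : False := by
  obtain ⟨a, b⟩ := w
  refine false_of_rootExits_uncrossed hh ω h fun t ht => ?_
  cases t
  · exact absurd rfl ht
  · -- exit `E` into `rootE = (a + 1, b)`: a dead end with door `W`
    right
    have e : Face.side ((a, b) : Face) .E = Face.side ((a + 1, b) : Face) .W := by simp [Face.side]
    rw [e]
    refine nth_ne_side_of_deadEnd hh hr h (g := ((a + 1, b) : Face)) ?_ ?_ (fun u hu => ?_)
    · simp [Prod.ext_iff]
    · simp only [farW, ne_eq, Prod.ext_iff, not_and]; intro h8; omega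
    · cases u
      · exact absurd rfl hu
      · right; simpa [Face.side, MidEdge.faces, show a + 1 + 1 = a + 2 by ring] using h7
      · left; simpa [Face.side, MidEdge.faces] using h3
      · right; simpa [Face.side, MidEdge.faces] using h6
  · -- exit `S` into `rootS = (a, b - 1)`: a dead end with door `N`
    right
    have e : Face.side ((a, b) : Face) .S = Face.side ((a, b - 1) : Face) .N := by simp only [Face.side]; congr 1; ring
    rw [e]
    refine nth_ne_side_of_deadEnd hh hr h (g := ((a, b - 1) : Face)) ?_ ?_ (fun u hu => ?_)
    · simp [Prod.ext_iff]
    · simp [farW, Prod.ext_iff]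
    · cases u
      · left; simpa [Face.side, MidEdge.faces] using h1
      · right; simpa [Face.side, MidEdge.faces] using h3
      · left; simpa [Face.side, MidEdge.faces, show b - 1 - 1 = b - 2 by ring] using h2
      · exact absurd rfl hu
  · -- exit `N` into `rootN = (a, b + 1)`: a dead end with door `S`
    right
    have e : Face.side ((a, b) : Face) .N = Face.side ((a, b + 1) : Face) .S := by simp [Face.side]
    rw [e]
    refine nth_ne_side_of_deadEnd hh hr h (g := ((a, b + 1) : Face)) ?_ ?_ (fun u hu => ?_)
    · simp [Prod.ext_iff]
    · simp [farW, Prod.ext_iff]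
    · cases u
      · left; simpa [Face.side, MidEdge.faces] using h4
      · right; simpa [Face.side, MidEdge.faces] using h6
      · exact absurd rfl hu
      · right; simpa [Face.side, MidEdge.faces, show b + 1 + 1 = b + 2 by ring] using h5

/-- …hence, vacuously, with the three exit cells dead ends every class-`B2a` walk at the far cell is unwound.
[cite: Glazman2015WeightedSAW, Lemma 3.1 (proof, pp. 6–7)] [cite: GlazmanManolescu2019, Lemma 2.1] -/
theorem WE_eq_excursionWinding_of_rootExit_deadEnds (hh : holeFaceW w ∉ D)
    (h1 : ((w.1 - 1, w.2 - 1) : Face) ∉ D) (h2 : ((w.1, w.2 - 2) : Face) ∉ D) (h3 : ((w.1 + 1, w.2 - 1) : Face) ∉ D)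
    (h4 : ((w.1 - 1, w.2 + 1) : Face) ∉ D) (h5 : ((w.1, w.2 + 2) : Face) ∉ D) (h6 : ((w.1 + 1, w.2 + 1) : Face) ∉ D)
    (h7 : ((w.1 + 2, w.2) : Face) ∉ D)
    (ω : ΩG D (w.side .W) (farW w)) (hr : RootedFace D (w.side .W) (farW w)) (h : ω.IsB2a) (θ : ℝ) :
    ω.WE (fun _ => θ) = excursionWinding θ ω.2.firstSideG (ω.z1 hr h) ω.1 :=
  (false_of_rootExit_deadEnds hh ω hr h h1 h2 h3 h4 h5 h6 h7).elim

end ΩG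

end Literature.Probability.RandomPlanarGeometry.SAW.YangBaxter

namespace Literature.Barriers.CriticalPhenomena.PlaquetteWalk

open Literature.Probability.RandomPlanarGeometry.SAW.YangBaxter
open Real Complex

/-! ## §2 The vertex functional -/

section RootExitVF

variable {Dl : List Face} {w : Face}

/-- ★★★ **THE THREE EXIT CELLS DEAD ENDS ⇒ `V ≡ 0`** (far cell present, hole absent, the seven cells around `rootS`, `rootN`, `rootE` listed in
`ΩG.false_of_rootExit_deadEnds` absent; the exit cells themselves may be present). [cite: GlazmanManolescu2019, Lemma 2.1 (statement, "in the form given in [Gl]"), §1 eq. (1)]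
[cite: Glazman2015WeightedSAW, Lemma 3.1 (proof, pp. 6–7)] -/
theorem vertexFunctional_printed_eq_zero_of_rootExit_deadEnds {θ : ℝ} (hθ : θ ∈ Set.Icc (π / 3) (2 * π / 3))
    (hf : farW w ∈ Dl) (hh : holeFaceW w ∉ dom Dl)
    (h1 : ((w.1 - 1, w.2 - 1) : Face) ∉ dom Dl) (h2 : ((w.1, w.2 - 2) : Face) ∉ dom Dl) (h3 : ((w.1 + 1, w.2 - 1) : Face) ∉ dom Dl)
    (h4 : ((w.1 - 1, w.2 + 1) : Face) ∉ dom Dl) (h5 : ((w.1, w.2 + 2) : Face) ∉ dom Dl) (h6 : ((w.1 + 1, w.2 + 1) : Face) ∉ dom Dl)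
    (h7 : ((w.1 + 2, w.2) : Face) ∉ dom Dl) :
    vertexFunctional (printedWeights θ) tFiveEighths (ybCoeff θ) Dl (w.side .W) (farW w) = 0 :=
  vertexFunctional_printed_eq_zero_of_both_unwound hθ hf hh fun hr ω h =>
    ΩG.WE_eq_excursionWinding_of_rootExit_deadEnds hh h1 h2 h3 h4 h5 h6 h7 ω hr h θ

end RootExitVF

end Literature.Barriers.CriticalPhenomena.PlaquetteWalk
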